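import Mathlib.Analysis.InnerProductSpace.PiL2

/-!
# Tight frames from the second-moment (2-design) identity

Framing: lottery ticket; floor = certified bounds/negative ranges. Venture `PackingBounds` (cell
`pub-packcert`, recognition seat, T5.md §9 (K5)).

For a finite family `C` of UNIT vectors in a finite-dimensional real inner product space `E` of
dimension `n ≥ 1` one always has `Σ_{x,y∈C} ⟨x,y⟩² ≥ |C|²/n`, with equality iff `C` is a tight frame:
`Σ_{x∈C} ⟨x,v⟩² = (|C|/n)‖v‖²` for every `v` (`sum_sq_inner_eq_of_pairSum_sq_eq`). Proof: with an
orthonormal basis `b` and the second-moment matrix `M_ij = Σ_x ⟨x,b_i⟩⟨x,b_j⟩` (written out inline; no definitions), Parseval gives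
`Σ_{x,y}⟨x,y⟩² = Σ_{ij} M_ij²` and `Σ_i M_ii = |C|`, hence `Σ_{ij} (M_ij − (|C|/n)δ_ij)² = Σ⟨x,y⟩² − |C|²/n`.
This is the step "a₂ > 0 ⇒ the code is a tight frame" of the complementary-slackness argument of
T5.md §5 (the Gegenbauer polynomial `P₂(u)` is an increasing affine function of `u²`, and its two-point
sum vanishes exactly when `Σ⟨x,y⟩² = |C|²/n`).
-/

open Finset
open scoped RealInnerProductSpace BigOperators

namespace Summit.Ventures.PackingBounds.SphericalCodes

variable {E : Type*} [NormedAddCommGroup E] [InnerProductSpace ℝ E]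
variable {ι : Type*} [Fintype ι] [DecidableEq ι]

omit [DecidableEq ι] in
/-- Parseval twice: `Σ_{x,y∈C} ⟨x,y⟩² = Σ_{i,j} M_ij²` with `M_ij = Σ_x ⟨x,b_i⟩⟨x,b_j⟩` in an orthonormal basis `b`. -/
private theorem pairSum_sq_eq_sum_mom_sq (b : OrthonormalBasis ι ℝ E) (C : Finset E) :
    ∑ x ∈ C, ∑ y ∈ C, (inner ℝ x y) ^ 2 = ∑ i, ∑ j, (∑ x ∈ C, inner ℝ x (b i) * inner ℝ x (b j)) ^ 2 := by
  -- ⟪x,y⟫ = Σ_i ⟪x,b i⟫⟪b i,y⟫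
  have hP : ∀ x y : E, inner ℝ x y = ∑ i, inner ℝ x (b i) * inner ℝ (b i) y := fun x y =>
    (b.sum_inner_mul_inner x y).symm
  have hxy : ∀ x y : E, (inner ℝ x y) ^ 2
      = ∑ i, ∑ j, (inner ℝ x (b i) * inner ℝ x (b j)) * (inner ℝ y (b i) * inner ℝ y (b j)) := by
    intro x y
    rw [sq, hP x y, Finset.sum_mul_sum]
    refine Finset.sum_congr rfl fun i _ => Finset.sum_congr rfl fun j _ => ?_
    rw [real_inner_comm (b i) y, real_inner_comm (b j) y]; ring
  simp_rw [hxy]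
  -- swap the sums: Σ_x Σ_y Σ_i Σ_j  →  Σ_i Σ_j Σ_x Σ_y
  rw [Finset.sum_comm]
  conv_lhs => arg 2; ext y; rw [Finset.sum_comm]
  rw [Finset.sum_comm]
  refine Finset.sum_congr rfl fun i _ => ?_
  rw [Finset.sum_comm]
  conv_lhs => arg 2; ext y; rw [Finset.sum_comm]
  rw [Finset.sum_comm]
  refine Finset.sum_congr rfl fun j _ => ?_
  rw [sq, Finset.sum_mul_sum]

omit [DecidableEq ι] in
/-- The trace of the second-moment matrix of a family of unit vectors is its cardinality: `Σ_i M_ii = |C|`. -/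
private theorem trace_mom (b : OrthonormalBasis ι ℝ E) (C : Finset E) (hC : ∀ x ∈ C, ‖x‖ = 1) :
    ∑ i, (∑ x ∈ C, inner ℝ x (b i) * inner ℝ x (b i)) = (C.card : ℝ) := by
  rw [Finset.sum_comm]
  have : ∀ x ∈ C, (∑ i, inner ℝ x (b i) * inner ℝ x (b i)) = 1 := by
    intro x hx
    have h := b.sum_inner_mul_inner x x
    have e : (∑ i, inner ℝ x (b i) * inner ℝ x (b i)) = ∑ i, inner ℝ x (b i) * inner ℝ (b i) x :=
      Finset.sum_congr rfl fun i _ => by nth_rewrite 2 [real_inner_comm (b i) x]; rfl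
    rw [e, h, real_inner_self_eq_norm_sq, hC x hx]; norm_num
  rw [Finset.sum_congr rfl this, Finset.sum_const, nsmul_eq_mul, mul_one]

omit [DecidableEq ι] in
/-- `Σ_{x∈C} ⟨x,v⟩² = Σ_{i,j} M_ij ⟨b_i,v⟩⟨b_j,v⟩` (Parseval). -/
private theorem sum_sq_inner_eq_mom (b : OrthonormalBasis ι ℝ E) (C : Finset E) (v : E) :
    ∑ x ∈ C, (inner ℝ x v) ^ 2 = ∑ i, ∑ j, (∑ x ∈ C, inner ℝ x (b i) * inner ℝ x (b j)) * (inner ℝ (b i) v * inner ℝ (b j) v) := by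
  have hP : ∀ x : E, inner ℝ x v = ∑ i, inner ℝ x (b i) * inner ℝ (b i) v := fun x =>
    (b.sum_inner_mul_inner x v).symm
  have hx : ∀ x : E, (inner ℝ x v) ^ 2
      = ∑ i, ∑ j, (inner ℝ x (b i) * inner ℝ x (b j)) * (inner ℝ (b i) v * inner ℝ (b j) v) := by
    intro x
    rw [sq, hP x, Finset.sum_mul_sum]
    refine Finset.sum_congr rfl fun i _ => Finset.sum_congr rfl fun j _ => ?_
    ring
  simp_rw [hx]
  rw [Finset.sum_comm]
  refine Finset.sum_congr rfl fun i _ => ?_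
  rw [Finset.sum_comm]
  refine Finset.sum_congr rfl fun j _ => ?_
  rw [Finset.sum_mul]

/-- **Second-moment identity ⇒ tight frame.** Let `E` be a finite-dimensional real inner product
space of dimension `n ≥ 1` and `C` a finite set of unit vectors with `Σ_{x,y∈C} ⟨x,y⟩² = |C|²/n`. Then
`Σ_{x∈C} ⟨x,v⟩² = (|C|/n)‖v‖²` for every `v`. (Used in T5.md §5: `a₂ > 0` in a tight three-point
certificate forces the vanishing of the `P₂` two-point sum, i.e. this hypothesis.) -/
theorem sum_sq_inner_eq_of_pairSum_sq_eq [FiniteDimensional ℝ E] (C : Finset E)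
    (hC : ∀ x ∈ C, ‖x‖ = 1) (hn : 0 < Module.finrank ℝ E)
    (h : ∑ x ∈ C, ∑ y ∈ C, (inner ℝ x y) ^ 2 = (C.card : ℝ) ^ 2 / Module.finrank ℝ E) (v : E) :
    ∑ x ∈ C, (inner ℝ x v) ^ 2 = (C.card : ℝ) / Module.finrank ℝ E * ‖v‖ ^ 2 := by
  classical
  set n := Module.finrank ℝ E with hn'
  let b : OrthonormalBasis (Fin n) ℝ E := stdOrthonormalBasis ℝ E
  set c : ℝ := (C.card : ℝ) / n with hc
  have hnr : (0 : ℝ) < n := by exact_mod_cast hn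
  -- Σ_{ij} (M_ij − c δ_ij)² = Σ M² − 2c tr M + n c² = 0
  have hM2 : ∑ i, ∑ j, (∑ x ∈ C, inner ℝ x (b i) * inner ℝ x (b j)) ^ 2 = (C.card : ℝ) ^ 2 / n := by
    rw [← pairSum_sq_eq_sum_mom_sq b C]; exact h
  have htr : ∑ i, (∑ x ∈ C, inner ℝ x (b i) * inner ℝ x (b i)) = (C.card : ℝ) := trace_mom b C hC
  have hzero : ∑ i, ∑ j, ((∑ x ∈ C, inner ℝ x (b i) * inner ℝ x (b j)) - if i = j then c else 0) ^ 2 = 0 := by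
    have hexp : ∀ i j : Fin n, ((∑ x ∈ C, inner ℝ x (b i) * inner ℝ x (b j)) - if i = j then c else 0) ^ 2
        = (∑ x ∈ C, inner ℝ x (b i) * inner ℝ x (b j)) ^ 2 - 2 * c * (if i = j then (∑ x ∈ C, inner ℝ x (b i) * inner ℝ x (b j)) else 0) + (if i = j then c ^ 2 else 0) := by
      intro i j
      by_cases hij : i = j
      · subst hij; simp; ring
      · simp [hij]
    simp_rw [hexp, Finset.sum_add_distrib, Finset.sum_sub_distrib]
    rw [hM2]
    simp only [Finset.sum_ite_eq, Finset.mem_univ, if_true, ← Finset.mul_sum]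
    rw [htr, Finset.sum_const, Finset.card_univ, Fintype.card_fin, nsmul_eq_mul, hc]
    field_simp
    ring
  -- hence every entry vanishes
  have hentry : ∀ i j : Fin n, (∑ x ∈ C, inner ℝ x (b i) * inner ℝ x (b j)) = if i = j then c else 0 := by
    intro i j
    have hnonneg : ∀ i ∈ (Finset.univ : Finset (Fin n)),
        0 ≤ ∑ j, ((∑ x ∈ C, inner ℝ x (b i) * inner ℝ x (b j)) - if i = j then c else 0) ^ 2 :=
      fun i _ => Finset.sum_nonneg fun j _ => sq_nonneg _
    have hi := (Finset.sum_eq_zero_iff_of_nonneg hnonneg).1 hzero i (Finset.mem_univ i)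
    have hj := (Finset.sum_eq_zero_iff_of_nonneg (fun j _ => sq_nonneg _)).1 hi j (Finset.mem_univ j)
    have := pow_eq_zero_iff (n := 2) (by norm_num) |>.1 hj
    linarith
  -- Σ_x ⟪x,v⟫² = Σ_ij M_ij ⟪b i,v⟫⟪b j,v⟫ = c Σ_i ⟪b i, v⟫² = c ‖v‖²
  rw [sum_sq_inner_eq_mom b C v]
  simp_rw [hentry]
  simp only [ite_mul, zero_mul, Finset.sum_ite_eq, Finset.mem_univ, if_true]
  rw [← Finset.mul_sum]
  congr 1
  have hv := b.sum_inner_mul_inner v v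
  rw [real_inner_self_eq_norm_sq] at hv
  rw [← hv]
  refine Finset.sum_congr rfl fun i _ => ?_
  rw [real_inner_comm (b i) v]

end Summit.Ventures.PackingBounds.SphericalCodes
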